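import Summits.Ventures.HodgeRepro.NightOpenInputs

/-!
# S1 from its printed statement: Milne 2020 §2.2 (r3) = Deligne 1982 §5 — «Σ_i φ_i(s) = p for all s ⇒ split Weil type»

Blind re-derivation cell `pub-hodge-repro`, seat `night-4` (ROUTE HARDENING for the Monday FINAL, gen 2).  Target tree path
`lean/Summits/Ventures/HodgeRepro/Night4SplitWeilCriterion.lean`.

ROUTE.md §1 row S1 / §2 L36 discharge S1 («A_Δ is of split Weil type») by Milne 2020 Thm 1's proof, whose printed
criterion is §2.2 (r3) — J. S. Milne, *Hodge classes on abelian varieties*, arXiv:2010.08857, store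
`paper:arxiv-2010.08857` p0004:L24–29 (read by the seat 2026-08-24T08:03Z), verbatim:

«Plain 2.2. (Deligne 1982, 5.) Let `F` be a CM-algebra, let `φ_1, …, φ_{2p}` be CM-types on `F`, and let `A = ∏_i A_i`,
where `A_i` is an abelian variety of CM-type `(F, φ_i)`. If `Σ_i φ_i(s) = p` for all `s ∈ T := Hom(F, ℚ^al)`, then `A`,
equipped with the diagonal action of `F`, is of split Weil type.»

and the line applying it to the corner product (p0005:L22–34): «Fix a subset `Δ` of `S := Hom(E, F)` satisfying
((eq2)). For `s ∈ Δ`, let `A_s = A ⊗_{E,s} F`. Then `A_s` is an abelian variety of CM type `(F, φ_s)`, where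
`φ_s(t) = φ(t ∘ s)` for `t ∈ T`. Because `Δ` satisfies ((eq2)), `Σ_{s∈Δ} φ_s(t) := Σ_{s∈Δ} φ(t ∘ s) = p`, all `t ∈ T`, and
so we can apply (r3): the abelian variety `A_Δ := ∏_{s∈Δ} A_s` equipped with the diagonal action of `F` is of split Weil
type.»

Gen 0's `RouteChain.lean` carries S1 as the Prop «(eq2) ⇒ `SplitWeil p (corner A Δ)`» with this quote in its docstring,
and `NightOpenInputs.lean` proves the combinatorial line `Eq2.sum_liftedType_eq` («Σ_{s∈Δ} φ_s(t) = p for all t»).  This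
file types the CRITERION ITSELF as the printed hypothesis — `Milne2020_2_2`: for `2p` corners (`|Δ| = 2p`) whose lifted
types `φ_s` satisfy `Σ_{s∈Δ} φ_s(t) = p` for every `t ∈ G`, the corner product is of split Weil type — and proves
`S1_of_Milne2020_2_2 : Milne2020_2_2 → S1`, so that S1 enters the chain in Milne's printed form (the (eq2) ⇒ Σ = p step
being kernel, `Eq2.sum_liftedType_eq`, and `|Δ| = 2p` from (eq2), `eq2_iff`).  NO open input is closed; HC_CM is NOT
proved; nothing here asserts anything about the original programme.
-/

open Finset

namespace HodgeRepro.Route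

namespace TypeDatum

variable (D : TypeDatum)

/-- **(eq2) forces `|Δ| = 2p`** (gen 0's `eq2_iff`): the `2p` corners of Milne's criterion. -/
theorem Eq2.card_eq_two_mul {p : ℕ} {Δ : Finset D.S} (h : D.Eq2 p Δ) : Δ.card = 2 * p :=
  ((D.eq2_iff p Δ).1 h).1

end TypeDatum

variable (𝓗 : RouteData)

/-- **Milne 2020, §2.2 (r3) = Deligne 1982 §5, on the corner products** — store p0004:L24–29 (quoted in the module
docstring), instantiated as Milne's proof of Theorem 1 does (p0005:L22–34): for a CM abelian variety `A` with type datum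
`(G, c, S, Φ)`, a set `Δ ⊂ S` of `2p` embeddings whose lifted CM types `φ_s = {t ∈ G : t • s ∈ Φ}` satisfy
`Σ_{s∈Δ} φ_s(t) = p` for every `t ∈ G` (here `Σ_{s∈Δ} φ_s(t) = |{s ∈ Δ : t ∈ φ_s}|`), the corner product
`A_Δ = ∏_{s∈Δ} A ⊗_{E,s} F` with the diagonal `F`-action is of split Weil type.  PRINTED. -/
def Milne2020_2_2 : Prop :=
  ∀ A : 𝓗.Var, 𝓗.IsCM A → ∀ (p : ℕ) (Δ : Finset (𝓗.typeOf A).S), Δ.card = 2 * p →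
    (∀ t : (𝓗.typeOf A).G, (Δ.filter fun s => t ∈ (𝓗.typeOf A).liftedType s).card = p) →
    𝓗.SplitWeil p (𝓗.corner A Δ)

/-- **S1 from Milne's printed criterion**: (eq2) gives `|Δ| = 2p` (`Eq2.card_eq_two_mul`) and
`Σ_{s∈Δ} φ_s(t) = p` for all `t` (`Eq2.sum_liftedType_eq`, the line of Milne's proof), so (r3) applies. -/
theorem S1_of_Milne2020_2_2 (h : Milne2020_2_2 𝓗) : S1 𝓗 :=
  fun A hA p Δ hΔ =>
    h A hA p Δ (hΔ.card_eq_two_mul (𝓗.typeOf A)) (fun t => hΔ.sum_liftedType_eq (𝓗.typeOf A) t)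

/-- **The deciding implication with S1 in its printed form**: `S0 ⇐ AlgPull ∧ Milne2020_2_2 ∧ S2 ∧ S3 ∧ S4`
(gen 0's `S0_of_S1_S2_S3_S4`). -/
theorem S0_of_Milne_S2_S3_S4 (hpull : AlgPull 𝓗) (h1 : Milne2020_2_2 𝓗) (h2 : S2 𝓗) (h3 : S3 𝓗) (h4 : S4 𝓗) :
    S0 𝓗 :=
  S0_of_S1_S2_S3_S4 𝓗 hpull ⟨S1_of_Milne2020_2_2 𝓗 h1, h2, h3, h4⟩

end HodgeRepro.Route
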